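import Summits.HubbardSuperconductivity.HubbardSuperconductivity.Theses.LogColdTorus
import Literature.MathematicalPhysics.QuantumLattice.HubbardTorusFlux
import HarnessLib

/-!
# Crux `LogColdDWaveOrder` (stmt-HubbardSuperconductivity-8807), line `birth` — BC3 birth skeleton

Route `LogColdTorus` (route-HubbardSuperconductivity-LogColdTorus), crux of rank 2 (the bet):
LOG-COLD d-WAVE ORDER of the pure model — `∃ δ ∈ (0,1/2), 0 < U₁ < U₂, κ₀ > 0, c > 0, ∀ κ ≥ κ₀,
∃ L₀, ∀ U ∈ (U₁,U₂), ∀ even L ≥ L₀: c·L⁴ ≤ Re ω^{sec}_{κ log L, L}(Δ_d†Δ_d)`, `ω^{sec}` the Gibbs state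
at the LOGARITHMIC inverse temperature `β_L = κ log L` of `hubbardTorus 2 L 1 U` compressed
(`Matrix.toBlock p p`) to the `(N_L, S^z = 0)` coordinate sector, `N_L = 2⌊(1-δ)L²/2⌋`,
`Δ_d = pairField dWaveFormFactor L`. The crux is open physics and is NOT settled here.

## The line = the route's own TWO-LAYER PLAN, typed

`LogColdDWaveOrder ⇐ LogColdStiffness → StiffnessToOrderAtThreshold` (route header, TWO-LAYER PLAN):

* **(S1) `stub_logColdStiffness` — LOG-COLD PAIR STIFFNESS (thermal Byers–Yang / Scalapino–White–Zhang
  flux criterion at `β_L = κ log L`, canonical sector).** There are `δ ∈ (0,1/4)`, a window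
  `0 < U₁ < U₂`, `κ₀ > 0` and a stiffness `ρ > 0` such that for every `κ ≥ κ₀`, eventually in even `L`
  and uniformly in `U ∈ (U₁,U₂)`, threading an Aharonov–Bohm flux `θ`, `|θ| ≤ π/2`, through one cycle
  of the torus (`hubbardTorusFlux L U θ`, seam Peierls phases; `hubbardTorusFlux_zero`) costs sector
  free energy at least `ρ θ²`:
  `Z^{sec}_L(κ log L; θ) ≤ exp(-ρ θ² · κ log L) · Z^{sec}_L(κ log L; 0) = L^{-κρθ²} Z^{sec}_L(κ log L; 0)`
  (`Matrix.partitionFn` of the sector-compressed twisted Hamiltonian). This is the 2D scale-invariant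
  helicity modulus `Υ(T_L) ≥ ρ/2 > 0` read at the Koma–Tasaki threshold temperature `T_L = 1/(κ log L)`:
  charge `e` is thermally dead there (`ThermalChargeDephasing`, Hastings 2004: one-body correlations
  `≤ C e^{-c₀ L/β_L}`), so an `O(1)` flux sensitivity on `|θ| ≤ π/2` is carried by charge `2e` and
  excludes metals (flat envelope), insulators and charge-`4e` condensates (which are flat at `θ = π/2`).
  OPEN: it is the superconducting window of the pure `t' = 0` model one thermal step up — the engine
  (positive-temperature fermionic multiscale analysis with `πT_L` as infrared cutoff; Benfatto–
  Giuliani–Mastropietro 2006, Feldman–Magnen–Rivasseau–Trubowitz) has never been run into a broken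
  phase; at `U ≈ 6–8`, `δ ≈ 1/8` stripes win (Qin et al. 2020).
* **(S2) `stub_stiffnessToOrderAtThreshold` — THE XY STEP AT THE THRESHOLD (Bramwell–Holdsworth scaling
  law).** For all data `δ ∈ (0,1/4)`, `0 < U₁ < U₂`, `κ₀, ρ > 0`: log-cold pair stiffness `ρ` on the
  window (the body of S1) forces log-cold `d_{x²-y²}` pair order with the THRESHOLD SCALING LAW
  `Re ω^{sec}_{κ log L, L}(Δ_d†Δ_d) ≥ A · exp(-B/(κρ)) · L⁴` for every `κ ≥ κ₀`, eventually in even `L`,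
  uniformly on the window, for some `A, B > 0` (spin-wave reading: a phase-stiff condensate on the
  `L × L` torus at `T_L` has `m² ≈ |ψ_d|² L^{-T_L/(2πΥ)} = |ψ_d|² e^{-1/(2πκΥ)}`; the vortex tail is the
  bounded `log L/β_L = 1/κ` of the route's calibration items `LogColdXYCalibration` (PROVED, classical
  `O(2)`) and `LogColdQuantumXYCalibration` (PROVED, quantum XY)). Channel selection is folded in: on
  `δ < 1/4` the leading singlet instability of the square lattice at `t' = 0` is `B₁g`
  (Raghu–Kivelson–Scalapino 2010; Deng–Kozik–Prokof'ev–Svistunov 2015), and a finite-momentum (PDW)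
  or `A₂g` condensate would void it — that is its "why it might fail". OPEN for fermions (pair
  formation + phase-only reduction at the thermal length `~ κ log L`); a theorem-in-kind for the
  classical and quantum rotators (the two calibration supports).

* **Glue `LogColdDWaveOrder_of : S1 → S2 → LogColdDWaveOrder`** (sorry-free, below): take the window and
  `ρ` from S1, the constants `A, B` from S2, and FIX THE UNIFORM CONSTANT `c := A · exp(-B/(κ₀ρ))`,
  which works for every `κ ≥ κ₀` because the scaling law is increasing in `κ`
  (`exp(-B/(κ₀ρ)) ≤ exp(-B/(κρ))` for `κ ≥ κ₀ > 0`, `ρ > 0`); `δ < 1/4 < 1/2`.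

Honours: no `Disproof.lean` exists for this crux (no `_false_without_` obstruction on record,
`ledger crux ls` 2026-08-17); `ledger negatives --problem HubbardSuperconductivity` (2 entries:
CooperPairDMottWalk breathing self-duality, AposterioriCapRg KLS-order openness) — neither concerns
flux/stiffness or log-cold Gibbs states. BC3 probes (folder `bc/`): `S1 → LogColdDWaveOrder`,
`S1 → HubbardSuperconductivity`, `S2 → LogColdDWaveOrder`, `S2 → HubbardSuperconductivity` by
`first | exact? | simpa | aesop` all FAIL (NOTES.md of the registrar session).

Sources: ByersYang1961; ScalapinoWhiteZhang1993 (doi:10.1103/physrevb.47.7995); KomaTasakiPRL1992;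
doi:10.1088/0953-8984/5/4/004 (Bramwell–Holdsworth); HastingsPRL2004FermiDecay
(doi:10.1103/physrevlett.93.126402); BenfattoGiulianiMastropietro2006; RaghuKivelsonScalapino2010;
arXiv:1408.4742 (Deng–Kozik–Prokof'ev–Svistunov, EPL 110 (2015) 57001); QinEtAl2020;
FriedliVelenik2017 Thm 10.24; KLS1988PRL. No definition is introduced.
-/

noncomputable section

-- the summit namespace repeats the problem name by design (D-0017)
set_option linter.dupNamespace false

namespace Summit.HubbardSuperconductivity.HubbardSuperconductivity.Cruxes.LogColdDWaveOrder.Birth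

open scoped BigOperators Topology Classical Matrix ComplexConjugate
open Filter Set Function
open Literature.Probability.LatticeModels Literature.MathematicalPhysics.QuantumLattice
open Summit.HubbardSuperconductivity.HubbardSuperconductivity.Theses.LogColdTorus

/-! ### The two stubs -/

/-- **Stub (S1) `stub_logColdStiffness`** — LOG-COLD PAIR STIFFNESS (thermal flux criterion at
`β_L = κ log L`, canonical `(N_L, S^z = 0)` sector): `∃ δ ∈ (0,1/4), 0 < U₁ < U₂, κ₀ > 0, ρ > 0,
∀ κ ≥ κ₀, ∃ L₀, ∀ U ∈ (U₁,U₂), ∀ even L ≥ L₀, ∀ |θ| ≤ π/2: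
Re Z(κ log L; (hubbardTorusFlux L U θ)|_sec) ≤ exp(-ρ θ² κ log L) · Re Z(κ log L; (hubbardTorus 2 L 1 U)|_sec)`
— the twist free energy `F_L(θ) - F_L(0) ≥ ρ θ²` up to half a pair flux quantum, i.e. helicity
modulus `≥ ρ/2` at the threshold temperature. OPEN (the superconducting window of the pure model,
thermal form). [cite: ScalapinoWhiteZhang1993, §II (D_s from the flux envelope)] -/
theorem stub_logColdStiffness :
    ∃ δ ∈ Set.Ioo (0:ℝ) (1/4), ∃ U₁ U₂ : ℝ, 0 < U₁ ∧ U₁ < U₂ ∧ ∃ κ₀ ρ : ℝ, 0 < κ₀ ∧ 0 < ρ ∧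
      ∀ κ : ℝ, κ₀ ≤ κ → ∃ L₀ : ℕ, ∀ U ∈ Set.Ioo U₁ U₂, ∀ (L : ℕ) [NeZero L], L₀ ≤ L → Even L →
        ∀ θ : ℝ, |θ| ≤ Real.pi / 2 →
          let p : Finset (Orb (FermionTorus 2 L)) → Prop := fun s =>
            s.card = 2 * ⌊(1 - δ) * (L : ℝ) ^ 2 / 2⌋₊ ∧
              2 * (s.filter fun i => (ofLex i).2 = 0).card = 2 * ⌊(1 - δ) * (L : ℝ) ^ 2 / 2⌋₊;
          (Matrix.partitionFn (κ * Real.log L) ((hubbardTorusFlux L U θ).toBlock p p)).re ≤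
            Real.exp (-(ρ * θ ^ 2 * (κ * Real.log L))) *
              (Matrix.partitionFn (κ * Real.log L) ((hubbardTorus 2 L 1 U).toBlock p p)).re := by
  sorry

/-- **Stub (S2) `stub_stiffnessToOrderAtThreshold`** — THE XY STEP AT THE KOMA–TASAKI THRESHOLD with
the Bramwell–Holdsworth scaling law: for all `δ ∈ (0,1/4)`, `0 < U₁ < U₂`, `κ₀ > 0`, `ρ > 0`, log-cold
pair stiffness `ρ` on the window (body of S1) implies `∃ A B > 0, ∀ κ ≥ κ₀, ∃ L₀, ∀ U ∈ (U₁,U₂),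
∀ even L ≥ L₀: A · exp(-B/(κρ)) · L⁴ ≤ Re ω^{sec}_{κ log L, L}(Δ_d†Δ_d)` (phase-stiff condensate on the
torus at `T_L = 1/(κ log L)`: `m² ≈ |ψ_d|² e^{-1/(2πκΥ)}`; `B₁g` selection on `δ < 1/4` folded in).
OPEN for fermions; theorem-in-kind for rotators (`LogColdXYCalibration`, `LogColdQuantumXYCalibration`,
both proved). [cite: doi:10.1088/0953-8984/5/4/004, eqs. (1)–(3) (finite-size magnetisation `L^{-T/(8πJ)}` per component)] -/
theorem stub_stiffnessToOrderAtThreshold :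
    ∀ δ ∈ Set.Ioo (0:ℝ) (1/4), ∀ (U₁ U₂ κ₀ ρ : ℝ), 0 < U₁ → U₁ < U₂ → 0 < κ₀ → 0 < ρ →
      (∀ κ : ℝ, κ₀ ≤ κ → ∃ L₀ : ℕ, ∀ U ∈ Set.Ioo U₁ U₂, ∀ (L : ℕ) [NeZero L], L₀ ≤ L → Even L →
        ∀ θ : ℝ, |θ| ≤ Real.pi / 2 →
          let p : Finset (Orb (FermionTorus 2 L)) → Prop := fun s =>
            s.card = 2 * ⌊(1 - δ) * (L : ℝ) ^ 2 / 2⌋₊ ∧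
              2 * (s.filter fun i => (ofLex i).2 = 0).card = 2 * ⌊(1 - δ) * (L : ℝ) ^ 2 / 2⌋₊;
          (Matrix.partitionFn (κ * Real.log L) ((hubbardTorusFlux L U θ).toBlock p p)).re ≤
            Real.exp (-(ρ * θ ^ 2 * (κ * Real.log L))) *
              (Matrix.partitionFn (κ * Real.log L) ((hubbardTorus 2 L 1 U).toBlock p p)).re) →
      ∃ A B : ℝ, 0 < A ∧ 0 < B ∧
        ∀ κ : ℝ, κ₀ ≤ κ → ∃ L₀ : ℕ, ∀ U ∈ Set.Ioo U₁ U₂, ∀ (L : ℕ) [NeZero L], L₀ ≤ L → Even L →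
          let p : Finset (Orb (FermionTorus 2 L)) → Prop := fun s =>
            s.card = 2 * ⌊(1 - δ) * (L : ℝ) ^ 2 / 2⌋₊ ∧
              2 * (s.filter fun i => (ofLex i).2 = 0).card = 2 * ⌊(1 - δ) * (L : ℝ) ^ 2 / 2⌋₊;
          A * Real.exp (-(B / (κ * ρ))) * (L : ℝ) ^ 4 ≤
            (Matrix.gibbsState (κ * Real.log L) ((hubbardTorus 2 L 1 U).toBlock p p)
              (((pairField dWaveFormFactor L)ᴴ * pairField dWaveFormFactor L).toBlock p p)).re := by
  sorry

/-! ### Composition: the crux modulo the two registered stubs -/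

/-- **The line closes the crux modulo its stubs**: `LogColdDWaveOrder` from the statements of
`stub_logColdStiffness` (S1) and `stub_stiffnessToOrderAtThreshold` (S2). The only mathematics in the
seam is the choice of the UNIFORM order constant `c := A · exp(-B/(κ₀ρ))`, valid for every `κ ≥ κ₀`
because the threshold scaling law `A e^{-B/(κρ)}` increases with `κ`; and `δ < 1/4 < 1/2`.
[folklore] -/
theorem LogColdDWaveOrder_of :
    (∃ δ ∈ Set.Ioo (0:ℝ) (1/4), ∃ U₁ U₂ : ℝ, 0 < U₁ ∧ U₁ < U₂ ∧ ∃ κ₀ ρ : ℝ, 0 < κ₀ ∧ 0 < ρ ∧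
      ∀ κ : ℝ, κ₀ ≤ κ → ∃ L₀ : ℕ, ∀ U ∈ Set.Ioo U₁ U₂, ∀ (L : ℕ) [NeZero L], L₀ ≤ L → Even L →
        ∀ θ : ℝ, |θ| ≤ Real.pi / 2 →
          let p : Finset (Orb (FermionTorus 2 L)) → Prop := fun s =>
            s.card = 2 * ⌊(1 - δ) * (L : ℝ) ^ 2 / 2⌋₊ ∧
              2 * (s.filter fun i => (ofLex i).2 = 0).card = 2 * ⌊(1 - δ) * (L : ℝ) ^ 2 / 2⌋₊;
          (Matrix.partitionFn (κ * Real.log L) ((hubbardTorusFlux L U θ).toBlock p p)).re ≤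
            Real.exp (-(ρ * θ ^ 2 * (κ * Real.log L))) *
              (Matrix.partitionFn (κ * Real.log L) ((hubbardTorus 2 L 1 U).toBlock p p)).re) →
    (∀ δ ∈ Set.Ioo (0:ℝ) (1/4), ∀ (U₁ U₂ κ₀ ρ : ℝ), 0 < U₁ → U₁ < U₂ → 0 < κ₀ → 0 < ρ →
      (∀ κ : ℝ, κ₀ ≤ κ → ∃ L₀ : ℕ, ∀ U ∈ Set.Ioo U₁ U₂, ∀ (L : ℕ) [NeZero L], L₀ ≤ L → Even L →
        ∀ θ : ℝ, |θ| ≤ Real.pi / 2 →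
          let p : Finset (Orb (FermionTorus 2 L)) → Prop := fun s =>
            s.card = 2 * ⌊(1 - δ) * (L : ℝ) ^ 2 / 2⌋₊ ∧
              2 * (s.filter fun i => (ofLex i).2 = 0).card = 2 * ⌊(1 - δ) * (L : ℝ) ^ 2 / 2⌋₊;
          (Matrix.partitionFn (κ * Real.log L) ((hubbardTorusFlux L U θ).toBlock p p)).re ≤
            Real.exp (-(ρ * θ ^ 2 * (κ * Real.log L))) *
              (Matrix.partitionFn (κ * Real.log L) ((hubbardTorus 2 L 1 U).toBlock p p)).re) →
      ∃ A B : ℝ, 0 < A ∧ 0 < B ∧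
        ∀ κ : ℝ, κ₀ ≤ κ → ∃ L₀ : ℕ, ∀ U ∈ Set.Ioo U₁ U₂, ∀ (L : ℕ) [NeZero L], L₀ ≤ L → Even L →
          let p : Finset (Orb (FermionTorus 2 L)) → Prop := fun s =>
            s.card = 2 * ⌊(1 - δ) * (L : ℝ) ^ 2 / 2⌋₊ ∧
              2 * (s.filter fun i => (ofLex i).2 = 0).card = 2 * ⌊(1 - δ) * (L : ℝ) ^ 2 / 2⌋₊;
          A * Real.exp (-(B / (κ * ρ))) * (L : ℝ) ^ 4 ≤
            (Matrix.gibbsState (κ * Real.log L) ((hubbardTorus 2 L 1 U).toBlock p p)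
              (((pairField dWaveFormFactor L)ᴴ * pairField dWaveFormFactor L).toBlock p p)).re) →
    LogColdDWaveOrder := by
  intro h1 h2
  obtain ⟨δ, hδ, U₁, U₂, hU₁, hU₁₂, κ₀, ρ, hκ₀, hρ, hstiff⟩ := h1
  obtain ⟨A, B, hA, hB, horder⟩ := h2 δ hδ U₁ U₂ κ₀ ρ hU₁ hU₁₂ hκ₀ hρ hstiff
  have hδ' : δ ∈ Set.Ioo (0:ℝ) (1/2) := ⟨hδ.1, hδ.2.trans (by norm_num)⟩
  refine ⟨δ, hδ', U₁, U₂, hU₁, hU₁₂, κ₀, A * Real.exp (-(B / (κ₀ * ρ))), hκ₀, by positivity, ?_⟩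
  intro κ hκ
  obtain ⟨L₀, hL₀⟩ := horder κ hκ
  refine ⟨L₀, ?_⟩
  intro U hU L _ hL hEven
  have h := hL₀ U hU L hL hEven
  have hκρ : κ₀ * ρ ≤ κ * ρ := mul_le_mul_of_nonneg_right hκ hρ.le
  have hκ₀ρ : 0 < κ₀ * ρ := mul_pos hκ₀ hρ
  have hdiv : B / (κ * ρ) ≤ B / (κ₀ * ρ) := div_le_div_of_nonneg_left hB.le hκ₀ρ hκρ
  have hmono : A * Real.exp (-(B / (κ₀ * ρ))) ≤ A * Real.exp (-(B / (κ * ρ))) :=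
    mul_le_mul_of_nonneg_left (Real.exp_le_exp.mpr (neg_le_neg hdiv)) hA.le
  have hL4 : (0:ℝ) ≤ (L : ℝ) ^ 4 := by positivity
  exact le_trans (mul_le_mul_of_nonneg_right hmono hL4) h

/-- The crux from the two stubs BY NAME (registered form `⟨S1, S2⟩ ↦ LogColdDWaveOrder`). [folklore] -/
theorem LogColdDWaveOrder_of_stubs : LogColdDWaveOrder :=
  LogColdDWaveOrder_of stub_logColdStiffness stub_stiffnessToOrderAtThreshold

end Summit.HubbardSuperconductivity.HubbardSuperconductivity.Cruxes.LogColdDWaveOrder.Birth
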